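import Summits.NavierStokesRegularity.NavierStokesRegularity.Theorems.ExtremiserTransienceNearExtremalTransienceExtremiserLiouvilleConstantSpeedSlideEnstrophyPlanar
import Literature.Analysis.FluidPDE.WholeSpaceIBPIntegrable
import Literature.Analysis.FluidPDE.HouLeiLiEstimate
import HarnessLib

/-!
# Crux `ExtremiserTransience.NearExtremalTransience` (stmt-NavierStokesRegularity-21883), line `extremiser_liouville`,
# stub K1b — IDENTITY (C1) `∫γ Δ_hφ·∂₂²φ = ∫γ|∇_h∂₂φ|² − ½∫γ″|∇_hφ|²` BY A DIVERGENCE CERTIFICATE (record §16, R6a-int)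

`--supports stmt-NavierStokesRegularity-21883` (helper).  Author: prover seat `ns-el-k1b` (g9).

The method of record §16 (addendum): the identity is `∫ div X = 0` for the explicit flux
`X = γ(x₂)∂₂²φ·∇_hφ + (−γ(x₂)⟪∇_hφ, ∇_h∂₂φ⟫ + ½γ′(x₂)|∇_hφ|²)·e₂`, a sum of (weight)·Dφ·D²φ products — so `X, div X ∈ L¹` as soon as
`Dφ, D²φ ∈ L²` and `γ, γ′, γ″` are bounded — although the pointwise expansion of `div X` passes through third derivatives of `φ`
(they cancel by the symmetry of mixed partials; `φ ∈ C^∞`).  No difference quotients, no slab hypothesis.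
* `divergence_laplacianAxialFlux` : the pointwise certificate `div X = γΔ_hφ∂₂²φ − γ|∇_h∂₂φ|² + ½γ″|∇_hφ|²`;
* `integral_axialWeight_laph_mul_dzdz_eq` : **(C1)** for a `C^∞` scalar `φ` with `Dφ, D²φ ∈ L²` (apply to `φ = V_j`).
With `|ΔV_h|² = |Δ_hV_h|² + 2Δ_hV_h·∂₂²V_h + |∂₂²V_h|²` this is identity (C) of record §2 (CAS-certified exactly, §15/§16).

WHAT THIS IS NOT: K1b is NOT proved; nothing here proves NS regularity. [folklore]
-/

noncomputable section

open Set Filter Topology MeasureTheory Metric Function InnerProductSpace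
open scoped ENNReal NNReal Topology InnerProductSpace RealInnerProductSpace ContDiff
open Literature.Analysis.FluidPDE Literature.Analysis

namespace Summit.NavierStokesRegularity.NavierStokesRegularity.Theorems

-- the problem directory repeats the summit name (`NavierStokesRegularity/NavierStokesRegularity`)
set_option linter.dupNamespace false

namespace ExtremiserLiouville

open DepletionLadder.KStar

variable {φ : EuclideanSpace ℝ (Fin 3) → ℝ} {γ : ℝ → ℝ}

/-- **The pointwise certificate.**  For `φ ∈ C^∞` and `γ ∈ C²`, with `∂ᵢ = D(·)(eᵢ)`:
the divergence of `X = (γ(x₂)∂₂²φ)·(∂₀φ e₀ + ∂₁φ e₁) + (−γ(x₂)(∂₀φ∂₀∂₂φ + ∂₁φ∂₁∂₂φ) + ½γ′(x₂)(∂₀φ² + ∂₁φ²))·e₂` is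
`γ(∂₀²φ + ∂₁²φ)∂₂²φ − γ((∂₀∂₂φ)² + (∂₁∂₂φ)²) + ½γ″(∂₀φ² + ∂₁φ²)`. [folklore] -/
theorem divergence_laplacianAxialFlux (hφ : ContDiff ℝ ∞ φ) (hγ : ContDiff ℝ 2 γ) (x : EuclideanSpace ℝ (Fin 3)) :
    VectorCalculus.divergence (fun y : EuclideanSpace ℝ (Fin 3) =>
        (γ (y 2) * fderiv ℝ (fun z => fderiv ℝ φ z (EuclideanSpace.single (2 : Fin 3) (1 : ℝ))) y (EuclideanSpace.single (2 : Fin 3) (1 : ℝ))) •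
            ((fderiv ℝ φ y (EuclideanSpace.single (0 : Fin 3) (1 : ℝ))) • EuclideanSpace.single (0 : Fin 3) (1 : ℝ) +
              (fderiv ℝ φ y (EuclideanSpace.single (1 : Fin 3) (1 : ℝ))) • EuclideanSpace.single (1 : Fin 3) (1 : ℝ)) +
          (-(γ (y 2) * (fderiv ℝ φ y (EuclideanSpace.single (0 : Fin 3) (1 : ℝ)) *
                fderiv ℝ (fun z => fderiv ℝ φ z (EuclideanSpace.single (2 : Fin 3) (1 : ℝ))) y (EuclideanSpace.single (0 : Fin 3) (1 : ℝ)) +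
              fderiv ℝ φ y (EuclideanSpace.single (1 : Fin 3) (1 : ℝ)) *
                fderiv ℝ (fun z => fderiv ℝ φ z (EuclideanSpace.single (2 : Fin 3) (1 : ℝ))) y (EuclideanSpace.single (1 : Fin 3) (1 : ℝ)))) +
            (1 / 2) * deriv γ (y 2) * (fderiv ℝ φ y (EuclideanSpace.single (0 : Fin 3) (1 : ℝ)) ^ 2 +
              fderiv ℝ φ y (EuclideanSpace.single (1 : Fin 3) (1 : ℝ)) ^ 2)) • EuclideanSpace.single (2 : Fin 3) (1 : ℝ)) x =
      γ (x 2) * (fderiv ℝ (fun z => fderiv ℝ φ z (EuclideanSpace.single (0 : Fin 3) (1 : ℝ))) x (EuclideanSpace.single (0 : Fin 3) (1 : ℝ)) +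
          fderiv ℝ (fun z => fderiv ℝ φ z (EuclideanSpace.single (1 : Fin 3) (1 : ℝ))) x (EuclideanSpace.single (1 : Fin 3) (1 : ℝ))) *
          fderiv ℝ (fun z => fderiv ℝ φ z (EuclideanSpace.single (2 : Fin 3) (1 : ℝ))) x (EuclideanSpace.single (2 : Fin 3) (1 : ℝ)) -
        γ (x 2) * (fderiv ℝ (fun z => fderiv ℝ φ z (EuclideanSpace.single (2 : Fin 3) (1 : ℝ))) x (EuclideanSpace.single (0 : Fin 3) (1 : ℝ)) ^ 2 +
          fderiv ℝ (fun z => fderiv ℝ φ z (EuclideanSpace.single (2 : Fin 3) (1 : ℝ))) x (EuclideanSpace.single (1 : Fin 3) (1 : ℝ)) ^ 2) +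
        (1 / 2) * deriv (deriv γ) (x 2) * (fderiv ℝ φ x (EuclideanSpace.single (0 : Fin 3) (1 : ℝ)) ^ 2 +
          fderiv ℝ φ x (EuclideanSpace.single (1 : Fin 3) (1 : ℝ)) ^ 2) := by
  set e₀ : EuclideanSpace ℝ (Fin 3) := EuclideanSpace.single (0 : Fin 3) (1 : ℝ) with he₀
  set e₁ : EuclideanSpace ℝ (Fin 3) := EuclideanSpace.single (1 : Fin 3) (1 : ℝ) with he₁
  set e₂ : EuclideanSpace ℝ (Fin 3) := EuclideanSpace.single (2 : Fin 3) (1 : ℝ) with he₂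
  have s02 : e₀ 2 = 0 := by simp [he₀]
  have s12 : e₁ 2 = 0 := by simp [he₁]
  have s22 : e₂ 2 = 1 := by simp [he₂]
  have s00 : e₀ 0 = 1 := by simp [he₀]
  have s11 : e₁ 1 = 1 := by simp [he₁]
  have s01 : e₀ 1 = 0 := by simp [he₀]
  have s10 : e₁ 0 = 0 := by simp [he₁]
  have s20 : e₂ 0 = 0 := by simp [he₂]
  have s21 : e₂ 1 = 0 := by simp [he₂]
  -- first derivatives `pᵢ = ∂ᵢφ` and second derivatives as functions
  have hD : ∀ v : EuclideanSpace ℝ (Fin 3), ContDiff ℝ ∞ fun y => fderiv ℝ φ y v := fun v =>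
    (hφ.fderiv_right (m := ∞) (by exact_mod_cast le_rfl)).clm_apply contDiff_const
  have hDD : ∀ v w : EuclideanSpace ℝ (Fin 3), ContDiff ℝ ∞ fun y => fderiv ℝ (fun z => fderiv ℝ φ z v) y w := fun v w =>
    ((hD v).fderiv_right (m := ∞) (by exact_mod_cast le_rfl)).clm_apply contDiff_const
  have dD : ∀ v, Differentiable ℝ fun y => fderiv ℝ φ y v := fun v => (hD v).differentiable (by simp)
  have dDD : ∀ v w, Differentiable ℝ fun y => fderiv ℝ (fun z => fderiv ℝ φ z v) y w := fun v w => (hDD v w).differentiable (by simp)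
  have hγd : Differentiable ℝ γ := hγ.differentiable two_ne_zero
  have hγ' : ContDiff ℝ 1 (deriv γ) := by
    have h2 : ContDiff ℝ (1 + 1) γ := by rw [show ((1 : WithTop ℕ∞) + 1) = 2 by norm_num]; exact hγ
    exact h2.deriv'
  have hγ'd : Differentiable ℝ (deriv γ) := hγ'.differentiable one_ne_zero
  -- symmetry of mixed partials: `∂_w∂_vφ = ∂_v∂_wφ`, and for `ψ = ∂₂φ`
  have hφ2 : ContDiff ℝ 2 φ := hφ.of_le (WithTop.coe_le_coe.mpr le_top)
  have sym : ∀ v w, fderiv ℝ (fun z => fderiv ℝ φ z v) x w = fderiv ℝ (fun z => fderiv ℝ φ z w) x v := fun v w =>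
    fderiv_fderiv_apply_comm_vec_scalar hφ2 x v w
  have hψ2 : ContDiff ℝ 2 (fun z => fderiv ℝ φ z e₂) := (hD e₂).of_le (WithTop.coe_le_coe.mpr le_top)
  have symψ : ∀ v w, fderiv ℝ (fun y => fderiv ℝ (fun z => fderiv ℝ φ z e₂) y v) x w =
      fderiv ℝ (fun y => fderiv ℝ (fun z => fderiv ℝ φ z e₂) y w) x v := fun v w =>
    fderiv_fderiv_apply_comm_vec_scalar hψ2 x v w
  -- names
  set p₀ : EuclideanSpace ℝ (Fin 3) → ℝ := fun y => fderiv ℝ φ y e₀ with hp₀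
  set p₁ : EuclideanSpace ℝ (Fin 3) → ℝ := fun y => fderiv ℝ φ y e₁ with hp₁
  set q₀ : EuclideanSpace ℝ (Fin 3) → ℝ := fun y => fderiv ℝ (fun z => fderiv ℝ φ z e₂) y e₀ with hq₀
  set q₁ : EuclideanSpace ℝ (Fin 3) → ℝ := fun y => fderiv ℝ (fun z => fderiv ℝ φ z e₂) y e₁ with hq₁
  set d : EuclideanSpace ℝ (Fin 3) → ℝ := fun y => fderiv ℝ (fun z => fderiv ℝ φ z e₂) y e₂ with hd
  set a : EuclideanSpace ℝ (Fin 3) → ℝ := fun y => γ (y 2) with ha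
  set b : EuclideanSpace ℝ (Fin 3) → ℝ := fun y => deriv γ (y 2) with hb
  have haD : ∀ y, HasFDerivAt a (deriv γ (y 2) • (EuclideanSpace.proj (2 : Fin 3) : EuclideanSpace ℝ (Fin 3) →L[ℝ] ℝ)) y :=
    fun y => hasFDerivAt_comp_coord hγd 2 y
  have hbD : ∀ y, HasFDerivAt b (deriv (deriv γ) (y 2) • (EuclideanSpace.proj (2 : Fin 3) : EuclideanSpace ℝ (Fin 3) →L[ℝ] ℝ)) y :=
    fun y => hasFDerivAt_comp_coord hγ'd 2 y
  have ad : Differentiable ℝ a := fun y => (haD y).differentiableAt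
  have bd : Differentiable ℝ b := fun y => (hbD y).differentiableAt
  -- the three scalar coefficient functions of `X = c₀ e₀ + c₁ e₁ + c₂ e₂`
  set c₀ : EuclideanSpace ℝ (Fin 3) → ℝ := fun y => a y * d y * p₀ y with hc₀
  set c₁ : EuclideanSpace ℝ (Fin 3) → ℝ := fun y => a y * d y * p₁ y with hc₁
  set c₂ : EuclideanSpace ℝ (Fin 3) → ℝ := fun y => -(a y * (p₀ y * q₀ y + p₁ y * q₁ y)) + (1 / 2) * b y * (p₀ y * p₀ y + p₁ y * p₁ y) with hc₂
  have hX : (fun y : EuclideanSpace ℝ (Fin 3) =>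
        (γ (y 2) * fderiv ℝ (fun z => fderiv ℝ φ z e₂) y e₂) • ((fderiv ℝ φ y e₀) • e₀ + (fderiv ℝ φ y e₁) • e₁) +
          (-(γ (y 2) * (fderiv ℝ φ y e₀ * fderiv ℝ (fun z => fderiv ℝ φ z e₂) y e₀ +
              fderiv ℝ φ y e₁ * fderiv ℝ (fun z => fderiv ℝ φ z e₂) y e₁)) +
            (1 / 2) * deriv γ (y 2) * (fderiv ℝ φ y e₀ ^ 2 + fderiv ℝ φ y e₁ ^ 2)) • e₂) =
      fun y => c₀ y • e₀ + c₁ y • e₁ + c₂ y • e₂ := by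
    funext y; simp only [hc₀, hc₁, hc₂, ha, hb, hd, hp₀, hp₁, hq₀, hq₁, smul_add, smul_smul, pow_two]
  have dc₀ : Differentiable ℝ c₀ := (ad.mul (dDD e₂ e₂)).mul (dD e₀)
  have dc₁ : Differentiable ℝ c₁ := (ad.mul (dDD e₂ e₂)).mul (dD e₁)
  have dc₂ : Differentiable ℝ c₂ :=
    (ad.mul (((dD e₀).mul (dDD e₂ e₀)).add ((dD e₁).mul (dDD e₂ e₁)))).neg.add
      ((bd.const_mul _).mul (((dD e₀).mul (dD e₀)).add ((dD e₁).mul (dD e₁))))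
  rw [hX, divergence_eq_sum_three]
  have hF : ∀ y, HasFDerivAt (fun y => c₀ y • e₀ + c₁ y • e₁ + c₂ y • e₂)
      ((fderiv ℝ c₀ y).smulRight e₀ + (fderiv ℝ c₁ y).smulRight e₁ + (fderiv ℝ c₂ y).smulRight e₂) y := fun y =>
    (((dc₀ y).hasFDerivAt.smul_const e₀).add ((dc₁ y).hasFDerivAt.smul_const e₁)).add ((dc₂ y).hasFDerivAt.smul_const e₂)
  rw [(hF x).fderiv]
  simp only [add_apply, ContinuousLinearMap.smulRight_apply, PiLp.add_apply, PiLp.smul_apply, smul_eq_mul,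
    s02, s12, s22, s00, s11, s01, s10, s20, s21, mul_zero, mul_one, add_zero, zero_add]
  -- the three partial derivatives of the coefficients
  have e_c₀ : fderiv ℝ c₀ x e₀ = a x * fderiv ℝ d x e₀ * p₀ x + a x * d x * fderiv ℝ p₀ x e₀ := by
    have h : HasFDerivAt (fun y => a y * d y * p₀ y)
        ((a x * d x) • fderiv ℝ p₀ x + p₀ x • (a x • fderiv ℝ d x + d x • (deriv γ (x 2) •
          (EuclideanSpace.proj (2 : Fin 3) : EuclideanSpace ℝ (Fin 3) →L[ℝ] ℝ)))) x :=
      ((haD x).mul (dDD e₂ e₂ x).hasFDerivAt).mul (dD e₀ x).hasFDerivAt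
    rw [show c₀ = fun y => a y * d y * p₀ y from rfl, h.fderiv]
    simp only [add_apply, smul_apply, smul_eq_mul, proj_two_apply, s02, mul_zero, add_zero, hd, hp₀]
    ring
  have e_c₁ : fderiv ℝ c₁ x e₁ = a x * fderiv ℝ d x e₁ * p₁ x + a x * d x * fderiv ℝ p₁ x e₁ := by
    have h : HasFDerivAt (fun y => a y * d y * p₁ y)
        ((a x * d x) • fderiv ℝ p₁ x + p₁ x • (a x • fderiv ℝ d x + d x • (deriv γ (x 2) •
          (EuclideanSpace.proj (2 : Fin 3) : EuclideanSpace ℝ (Fin 3) →L[ℝ] ℝ)))) x :=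
      ((haD x).mul (dDD e₂ e₂ x).hasFDerivAt).mul (dD e₁ x).hasFDerivAt
    rw [show c₁ = fun y => a y * d y * p₁ y from rfl, h.fderiv]
    simp only [add_apply, smul_apply, smul_eq_mul, proj_two_apply, s12, mul_zero, add_zero, hd, hp₁]
    ring
  have e_c₂ : fderiv ℝ c₂ x e₂ = -(deriv γ (x 2) * (p₀ x * q₀ x + p₁ x * q₁ x)) -
      a x * (fderiv ℝ p₀ x e₂ * q₀ x + p₀ x * fderiv ℝ q₀ x e₂ + (fderiv ℝ p₁ x e₂ * q₁ x + p₁ x * fderiv ℝ q₁ x e₂)) +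
      (1 / 2) * deriv (deriv γ) (x 2) * (p₀ x ^ 2 + p₁ x ^ 2) +
      (1 / 2) * deriv γ (x 2) * (2 * p₀ x * fderiv ℝ p₀ x e₂ + 2 * p₁ x * fderiv ℝ p₁ x e₂) := by
    have hin : HasFDerivAt (fun y => p₀ y * q₀ y + p₁ y * q₁ y)
        (p₀ x • fderiv ℝ q₀ x + q₀ x • fderiv ℝ p₀ x + (p₁ x • fderiv ℝ q₁ x + q₁ x • fderiv ℝ p₁ x)) x :=
      ((dD e₀ x).hasFDerivAt.mul (dDD e₂ e₀ x).hasFDerivAt).add ((dD e₁ x).hasFDerivAt.mul (dDD e₂ e₁ x).hasFDerivAt)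
    have hsq : HasFDerivAt (fun y => p₀ y * p₀ y + p₁ y * p₁ y)
        (p₀ x • fderiv ℝ p₀ x + p₀ x • fderiv ℝ p₀ x + (p₁ x • fderiv ℝ p₁ x + p₁ x • fderiv ℝ p₁ x)) x :=
      ((dD e₀ x).hasFDerivAt.mul (dD e₀ x).hasFDerivAt).add ((dD e₁ x).hasFDerivAt.mul (dD e₁ x).hasFDerivAt)
    have hb2 : HasFDerivAt (fun y => (1 / 2 : ℝ) * b y) ((1 / 2 : ℝ) • (deriv (deriv γ) (x 2) •
        (EuclideanSpace.proj (2 : Fin 3) : EuclideanSpace ℝ (Fin 3) →L[ℝ] ℝ))) x := (hbD x).const_mul (1 / 2)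
    have h : HasFDerivAt (fun y => -(a y * (p₀ y * q₀ y + p₁ y * q₁ y)) + (1 / 2) * b y * (p₀ y * p₀ y + p₁ y * p₁ y))
        (-(a x • (p₀ x • fderiv ℝ q₀ x + q₀ x • fderiv ℝ p₀ x + (p₁ x • fderiv ℝ q₁ x + q₁ x • fderiv ℝ p₁ x)) +
            (p₀ x * q₀ x + p₁ x * q₁ x) • (deriv γ (x 2) • (EuclideanSpace.proj (2 : Fin 3) : EuclideanSpace ℝ (Fin 3) →L[ℝ] ℝ))) +
          (((1 / 2 : ℝ) * b x) • (p₀ x • fderiv ℝ p₀ x + p₀ x • fderiv ℝ p₀ x + (p₁ x • fderiv ℝ p₁ x + p₁ x • fderiv ℝ p₁ x)) +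
            (p₀ x * p₀ x + p₁ x * p₁ x) • ((1 / 2 : ℝ) • (deriv (deriv γ) (x 2) •
              (EuclideanSpace.proj (2 : Fin 3) : EuclideanSpace ℝ (Fin 3) →L[ℝ] ℝ))))) x :=
      ((haD x).mul hin).neg.add (hb2.mul hsq)
    rw [show c₂ = fun y => -(a y * (p₀ y * q₀ y + p₁ y * q₁ y)) + (1 / 2) * b y * (p₀ y * p₀ y + p₁ y * p₁ y) from rfl, h.fderiv]
    simp only [add_apply, neg_apply, smul_apply, smul_eq_mul, proj_two_apply, s22, mul_one, ha, hb]
    ring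
  rw [e_c₀, e_c₁, e_c₂]
  -- symmetry substitutions: `∂ᵢd = ∂₂qᵢ`, `∂₂pᵢ = qᵢ`
  have r1 : fderiv ℝ d x e₀ = fderiv ℝ q₀ x e₂ := symψ e₂ e₀
  have r2 : fderiv ℝ d x e₁ = fderiv ℝ q₁ x e₂ := symψ e₂ e₁
  have r3 : fderiv ℝ p₀ x e₂ = q₀ x := sym e₀ e₂
  have r4 : fderiv ℝ p₁ x e₂ = q₁ x := sym e₁ e₂
  rw [r1, r2, r3, r4]
  simp only [ha, hd, hp₀, hp₁, hq₀, hq₁]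
  ring

/-- `|∂_w∂_vφ(y)| ≤ ‖D²φ(y)‖` for unit vectors (scalar `φ`). [folklore] -/
theorem abs_fderiv_fderiv_apply_le (hφ : ContDiff ℝ ∞ φ) (y v w : EuclideanSpace ℝ (Fin 3)) (hv : ‖v‖ = 1) (hw : ‖w‖ = 1) :
    |fderiv ℝ (fun z => fderiv ℝ φ z v) y w| ≤ ‖iteratedFDeriv ℝ 2 φ y‖ := by
  have hD : ContDiff ℝ ∞ (fderiv ℝ φ) := hφ.fderiv_right (m := ∞) (by exact_mod_cast le_rfl)
  have e1 : ‖iteratedFDeriv ℝ 0 (fderiv ℝ (fun z => fderiv ℝ φ z v)) y‖ = ‖iteratedFDeriv ℝ 1 (fun z => fderiv ℝ φ z v) y‖ :=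
    norm_iteratedFDeriv_fderiv
  have e2 : ‖iteratedFDeriv ℝ 1 (fderiv ℝ φ) y‖ = ‖iteratedFDeriv ℝ 2 φ y‖ := norm_iteratedFDeriv_fderiv
  rw [norm_iteratedFDeriv_zero] at e1
  rw [← Real.norm_eq_abs]
  calc ‖fderiv ℝ (fun z => fderiv ℝ φ z v) y w‖ ≤ ‖fderiv ℝ (fun z => fderiv ℝ φ z v) y‖ * ‖w‖ := ContinuousLinearMap.le_opNorm _ _
    _ = ‖iteratedFDeriv ℝ 1 (fun z => fderiv ℝ φ z v) y‖ := by rw [hw, mul_one, e1]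
    _ ≤ ‖v‖ * ‖iteratedFDeriv ℝ 1 (fderiv ℝ φ) y‖ :=
        norm_iteratedFDeriv_clm_apply_const (hD.of_le (by exact_mod_cast le_top)).contDiffAt le_rfl
    _ = ‖iteratedFDeriv ℝ 2 φ y‖ := by rw [hv, one_mul, e2]

/-- **(C1) `∫γ(x₂)Δ_hφ·∂₂²φ = ∫γ(x₂)|∇_h∂₂φ|² − ½∫γ″(x₂)|∇_hφ|²`** for `φ ∈ C^∞` with `Dφ, D²φ ∈ L²` and `γ ∈ C²` with
`γ, γ′, γ″` bounded (divergence certificate `divergence_laplacianAxialFlux`; no slab hypothesis, no `D³φ` integrability). [folklore] -/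
theorem integral_axialWeight_laph_mul_dzdz_eq (hφ : ContDiff ℝ ∞ φ) (hγ : ContDiff ℝ 2 γ) {K : ℝ}
    (hK0 : ∀ s, |γ s| ≤ K) (hK1 : ∀ s, |deriv γ s| ≤ K) (hK2 : ∀ s, |deriv (deriv γ) s| ≤ K)
    (i1 : Integrable (fun y => ‖fderiv ℝ φ y‖ ^ 2) (volume : Measure (EuclideanSpace ℝ (Fin 3))))
    (i2 : Integrable (fun y => ‖iteratedFDeriv ℝ 2 φ y‖ ^ 2) (volume : Measure (EuclideanSpace ℝ (Fin 3)))) :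
    (∫ x, γ (x 2) * (fderiv ℝ (fun z => fderiv ℝ φ z (EuclideanSpace.single (0 : Fin 3) (1 : ℝ))) x (EuclideanSpace.single (0 : Fin 3) (1 : ℝ)) + fderiv ℝ (fun z => fderiv ℝ φ z (EuclideanSpace.single (1 : Fin 3) (1 : ℝ))) x (EuclideanSpace.single (1 : Fin 3) (1 : ℝ))) * fderiv ℝ (fun z => fderiv ℝ φ z (EuclideanSpace.single (2 : Fin 3) (1 : ℝ))) x (EuclideanSpace.single (2 : Fin 3) (1 : ℝ))) =
      (∫ x, γ (x 2) * (fderiv ℝ (fun z => fderiv ℝ φ z (EuclideanSpace.single (2 : Fin 3) (1 : ℝ))) x (EuclideanSpace.single (0 : Fin 3) (1 : ℝ)) ^ 2 + fderiv ℝ (fun z => fderiv ℝ φ z (EuclideanSpace.single (2 : Fin 3) (1 : ℝ))) x (EuclideanSpace.single (1 : Fin 3) (1 : ℝ)) ^ 2)) -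
        (1 / 2) * ∫ x, deriv (deriv γ) (x 2) * (fderiv ℝ φ x (EuclideanSpace.single (0 : Fin 3) (1 : ℝ)) ^ 2 + fderiv ℝ φ x (EuclideanSpace.single (1 : Fin 3) (1 : ℝ)) ^ 2) := by
  have hKnn : 0 ≤ K := (abs_nonneg _).trans (hK0 0)
  have n0 : ‖(EuclideanSpace.single (0 : Fin 3) (1 : ℝ))‖ = 1 := by rw [PiLp.norm_single, norm_one]
  have n1 : ‖(EuclideanSpace.single (1 : Fin 3) (1 : ℝ))‖ = 1 := by rw [PiLp.norm_single, norm_one]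
  have n2 : ‖(EuclideanSpace.single (2 : Fin 3) (1 : ℝ))‖ = 1 := by rw [PiLp.norm_single, norm_one]
  have hproj : ContDiff ℝ ∞ fun y : EuclideanSpace ℝ (Fin 3) => y 2 := (EuclideanSpace.proj (2 : Fin 3) : EuclideanSpace ℝ (Fin 3) →L[ℝ] ℝ).contDiff
  have hD : ∀ v : EuclideanSpace ℝ (Fin 3), ContDiff ℝ ∞ fun y => fderiv ℝ φ y v := fun v =>
    (hφ.fderiv_right (m := ∞) (by exact_mod_cast le_rfl)).clm_apply contDiff_const
  have hDD : ∀ v w : EuclideanSpace ℝ (Fin 3), ContDiff ℝ ∞ fun y => fderiv ℝ (fun z => fderiv ℝ φ z v) y w := fun v w =>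
    ((hD v).fderiv_right (m := ∞) (by exact_mod_cast le_rfl)).clm_apply contDiff_const
  have cγ : ContDiff ℝ 2 fun y : EuclideanSpace ℝ (Fin 3) => γ (y 2) := hγ.comp (EuclideanSpace.proj (2 : Fin 3) : EuclideanSpace ℝ (Fin 3) →L[ℝ] ℝ).contDiff
  have hγ' : ContDiff ℝ 1 (deriv γ) := by
    have h2 : ContDiff ℝ (1 + 1) γ := by rw [show ((1 : WithTop ℕ∞) + 1) = 2 by norm_num]; exact hγ
    exact h2.deriv'
  have cγ' : ContDiff ℝ 1 fun y : EuclideanSpace ℝ (Fin 3) => deriv γ (y 2) := hγ'.comp (EuclideanSpace.proj (2 : Fin 3) : EuclideanSpace ℝ (Fin 3) →L[ℝ] ℝ).contDiff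
  have cγ'' : Continuous fun y : EuclideanSpace ℝ (Fin 3) => deriv (deriv γ) (y 2) :=
    (contDiff_one_iff_deriv.1 hγ').2.comp (PiLp.continuous_apply 2 _ (2 : Fin 3))
  -- pointwise bounds: `|∂ᵢφ| ≤ ‖Dφ‖`, `|∂_w∂_vφ| ≤ ‖D²φ‖`
  have bp : ∀ (y v : EuclideanSpace ℝ (Fin 3)), ‖v‖ = 1 → |fderiv ℝ φ y v| ≤ ‖fderiv ℝ φ y‖ := fun y v hv => by
    rw [← Real.norm_eq_abs]; exact ((fderiv ℝ φ y).le_opNorm v).trans (by rw [hv, mul_one])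
  have bq := fun (y v w : EuclideanSpace ℝ (Fin 3)) (hv : ‖v‖ = 1) (hw : ‖w‖ = 1) => abs_fderiv_fderiv_apply_le hφ y v w hv hw
  -- the flux is `C¹`
  have lt1 : ((1 : ℕ) : WithTop ℕ∞) ≤ ((⊤ : ℕ∞) : WithTop ℕ∞) := WithTop.coe_le_coe.mpr le_top
  have hH : ContDiff ℝ 1 fun y : EuclideanSpace ℝ (Fin 3) => (fderiv ℝ φ y (EuclideanSpace.single (0 : Fin 3) (1 : ℝ))) • EuclideanSpace.single (0 : Fin 3) (1 : ℝ) + (fderiv ℝ φ y (EuclideanSpace.single (1 : Fin 3) (1 : ℝ))) • EuclideanSpace.single (1 : Fin 3) (1 : ℝ) :=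
    (((hD _).smul contDiff_const).add ((hD _).smul contDiff_const)).of_le lt1
  have hc0 : ContDiff ℝ 1 fun y : EuclideanSpace ℝ (Fin 3) => γ (y 2) * fderiv ℝ (fun z => fderiv ℝ φ z (EuclideanSpace.single (2 : Fin 3) (1 : ℝ))) y (EuclideanSpace.single (2 : Fin 3) (1 : ℝ)) :=
    (cγ.of_le (by norm_num)).mul ((hDD _ _).of_le lt1)
  have hin : ContDiff ℝ 1 fun y : EuclideanSpace ℝ (Fin 3) => fderiv ℝ φ y (EuclideanSpace.single (0 : Fin 3) (1 : ℝ)) * fderiv ℝ (fun z => fderiv ℝ φ z (EuclideanSpace.single (2 : Fin 3) (1 : ℝ))) y (EuclideanSpace.single (0 : Fin 3) (1 : ℝ)) + fderiv ℝ φ y (EuclideanSpace.single (1 : Fin 3) (1 : ℝ)) * fderiv ℝ (fun z => fderiv ℝ φ z (EuclideanSpace.single (2 : Fin 3) (1 : ℝ))) y (EuclideanSpace.single (1 : Fin 3) (1 : ℝ)) :=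
    (((hD _).mul (hDD _ _)).add ((hD _).mul (hDD _ _))).of_le lt1
  have hsq : ContDiff ℝ 1 fun y : EuclideanSpace ℝ (Fin 3) => fderiv ℝ φ y (EuclideanSpace.single (0 : Fin 3) (1 : ℝ)) ^ 2 + fderiv ℝ φ y (EuclideanSpace.single (1 : Fin 3) (1 : ℝ)) ^ 2 :=
    (((hD _).pow 2).add ((hD _).pow 2)).of_le lt1
  have hc2 : ContDiff ℝ 1 fun y : EuclideanSpace ℝ (Fin 3) => -(γ (y 2) * (fderiv ℝ φ y (EuclideanSpace.single (0 : Fin 3) (1 : ℝ)) * fderiv ℝ (fun z => fderiv ℝ φ z (EuclideanSpace.single (2 : Fin 3) (1 : ℝ))) y (EuclideanSpace.single (0 : Fin 3) (1 : ℝ)) + fderiv ℝ φ y (EuclideanSpace.single (1 : Fin 3) (1 : ℝ)) * fderiv ℝ (fun z => fderiv ℝ φ z (EuclideanSpace.single (2 : Fin 3) (1 : ℝ))) y (EuclideanSpace.single (1 : Fin 3) (1 : ℝ)))) +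
      (1 / 2) * deriv γ (y 2) * (fderiv ℝ φ y (EuclideanSpace.single (0 : Fin 3) (1 : ℝ)) ^ 2 + fderiv ℝ φ y (EuclideanSpace.single (1 : Fin 3) (1 : ℝ)) ^ 2) :=
    (((cγ.of_le (by norm_num)).mul hin).neg).add ((contDiff_const.mul cγ').mul hsq)
  have hX1 : ContDiff ℝ 1 fun y : EuclideanSpace ℝ (Fin 3) => (γ (y 2) * fderiv ℝ (fun z => fderiv ℝ φ z (EuclideanSpace.single (2 : Fin 3) (1 : ℝ))) y (EuclideanSpace.single (2 : Fin 3) (1 : ℝ))) •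
            ((fderiv ℝ φ y (EuclideanSpace.single (0 : Fin 3) (1 : ℝ))) • EuclideanSpace.single (0 : Fin 3) (1 : ℝ) +
              (fderiv ℝ φ y (EuclideanSpace.single (1 : Fin 3) (1 : ℝ))) • EuclideanSpace.single (1 : Fin 3) (1 : ℝ)) +
          (-(γ (y 2) * (fderiv ℝ φ y (EuclideanSpace.single (0 : Fin 3) (1 : ℝ)) *
                fderiv ℝ (fun z => fderiv ℝ φ z (EuclideanSpace.single (2 : Fin 3) (1 : ℝ))) y (EuclideanSpace.single (0 : Fin 3) (1 : ℝ)) +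
              fderiv ℝ φ y (EuclideanSpace.single (1 : Fin 3) (1 : ℝ)) *
                fderiv ℝ (fun z => fderiv ℝ φ z (EuclideanSpace.single (2 : Fin 3) (1 : ℝ))) y (EuclideanSpace.single (1 : Fin 3) (1 : ℝ)))) +
            (1 / 2) * deriv γ (y 2) * (fderiv ℝ φ y (EuclideanSpace.single (0 : Fin 3) (1 : ℝ)) ^ 2 +
              fderiv ℝ φ y (EuclideanSpace.single (1 : Fin 3) (1 : ℝ)) ^ 2)) • EuclideanSpace.single (2 : Fin 3) (1 : ℝ) := (hc0.smul hH).add (hc2.smul contDiff_const)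
  -- the flux is integrable
  have iX : Integrable (fun y : EuclideanSpace ℝ (Fin 3) => (γ (y 2) * fderiv ℝ (fun z => fderiv ℝ φ z (EuclideanSpace.single (2 : Fin 3) (1 : ℝ))) y (EuclideanSpace.single (2 : Fin 3) (1 : ℝ))) •
            ((fderiv ℝ φ y (EuclideanSpace.single (0 : Fin 3) (1 : ℝ))) • EuclideanSpace.single (0 : Fin 3) (1 : ℝ) +
              (fderiv ℝ φ y (EuclideanSpace.single (1 : Fin 3) (1 : ℝ))) • EuclideanSpace.single (1 : Fin 3) (1 : ℝ)) +
          (-(γ (y 2) * (fderiv ℝ φ y (EuclideanSpace.single (0 : Fin 3) (1 : ℝ)) *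
                fderiv ℝ (fun z => fderiv ℝ φ z (EuclideanSpace.single (2 : Fin 3) (1 : ℝ))) y (EuclideanSpace.single (0 : Fin 3) (1 : ℝ)) +
              fderiv ℝ φ y (EuclideanSpace.single (1 : Fin 3) (1 : ℝ)) *
                fderiv ℝ (fun z => fderiv ℝ φ z (EuclideanSpace.single (2 : Fin 3) (1 : ℝ))) y (EuclideanSpace.single (1 : Fin 3) (1 : ℝ)))) +
            (1 / 2) * deriv γ (y 2) * (fderiv ℝ φ y (EuclideanSpace.single (0 : Fin 3) (1 : ℝ)) ^ 2 +
              fderiv ℝ φ y (EuclideanSpace.single (1 : Fin 3) (1 : ℝ)) ^ 2)) • EuclideanSpace.single (2 : Fin 3) (1 : ℝ)) volume := by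
    refine (((i1.add i2).const_mul (3 * K))).mono' hX1.continuous.aestronglyMeasurable (Eventually.of_forall fun y => ?_)
    simp only [Pi.add_apply]
    set P := ‖fderiv ℝ φ y‖ with hP
    set Q := ‖iteratedFDeriv ℝ 2 φ y‖ with hQ
    have hP0 : 0 ≤ P := norm_nonneg _
    have hQ0 : 0 ≤ Q := norm_nonneg _
    have a0 := bp y _ n0; have a1 := bp y _ n1
    have d22 := bq y _ _ n2 n2; have d20 := bq y _ _ n2 n0; have d21 := bq y _ _ n2 n1
    have g0 := hK0 (y 2); have g1 := hK1 (y 2)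
    refine (norm_add_le _ _).trans ?_
    rw [norm_smul, norm_smul, n2, mul_one, Real.norm_eq_abs, Real.norm_eq_abs, abs_mul]
    have hh : ‖(fderiv ℝ φ y (EuclideanSpace.single (0 : Fin 3) (1 : ℝ))) • EuclideanSpace.single (0 : Fin 3) (1 : ℝ) + (fderiv ℝ φ y (EuclideanSpace.single (1 : Fin 3) (1 : ℝ))) • EuclideanSpace.single (1 : Fin 3) (1 : ℝ)‖ ≤ 2 * P := by
      refine (norm_add_le _ _).trans ?_
      rw [norm_smul, norm_smul, n0, n1, mul_one, mul_one, Real.norm_eq_abs, Real.norm_eq_abs]; linarith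
    have t1 : |γ (y 2)| * |fderiv ℝ (fun z => fderiv ℝ φ z (EuclideanSpace.single (2 : Fin 3) (1 : ℝ))) y (EuclideanSpace.single (2 : Fin 3) (1 : ℝ))| * ‖(fderiv ℝ φ y (EuclideanSpace.single (0 : Fin 3) (1 : ℝ))) • EuclideanSpace.single (0 : Fin 3) (1 : ℝ) + (fderiv ℝ φ y (EuclideanSpace.single (1 : Fin 3) (1 : ℝ))) • EuclideanSpace.single (1 : Fin 3) (1 : ℝ)‖ ≤ K * Q * (2 * P) :=
      mul_le_mul (mul_le_mul g0 d22 (abs_nonneg _) hKnn) hh (norm_nonneg _) (by positivity)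
    have t2 : |-(γ (y 2) * (fderiv ℝ φ y (EuclideanSpace.single (0 : Fin 3) (1 : ℝ)) * fderiv ℝ (fun z => fderiv ℝ φ z (EuclideanSpace.single (2 : Fin 3) (1 : ℝ))) y (EuclideanSpace.single (0 : Fin 3) (1 : ℝ)) + fderiv ℝ φ y (EuclideanSpace.single (1 : Fin 3) (1 : ℝ)) * fderiv ℝ (fun z => fderiv ℝ φ z (EuclideanSpace.single (2 : Fin 3) (1 : ℝ))) y (EuclideanSpace.single (1 : Fin 3) (1 : ℝ)))) +
        (1 / 2) * deriv γ (y 2) * (fderiv ℝ φ y (EuclideanSpace.single (0 : Fin 3) (1 : ℝ)) ^ 2 + fderiv ℝ φ y (EuclideanSpace.single (1 : Fin 3) (1 : ℝ)) ^ 2)| ≤ K * (P * Q + P * Q) + (1 / 2) * K * (P ^ 2 + P ^ 2) := by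
      refine (abs_add_le _ _).trans (add_le_add ?_ ?_)
      · rw [abs_neg, abs_mul]
        refine mul_le_mul g0 ((abs_add_le _ _).trans (add_le_add ?_ ?_)) (abs_nonneg _) hKnn
        · rw [abs_mul]; exact mul_le_mul a0 d20 (abs_nonneg _) hP0
        · rw [abs_mul]; exact mul_le_mul a1 d21 (abs_nonneg _) hP0
      · rw [abs_mul, abs_mul, abs_of_pos (by norm_num : (0:ℝ) < 1 / 2)]
        refine mul_le_mul (mul_le_mul_of_nonneg_left g1 (by norm_num)) ?_ (abs_nonneg _) (by positivity)
        rw [abs_of_nonneg (by positivity)]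
        have e0' : fderiv ℝ φ y (EuclideanSpace.single (0 : Fin 3) (1 : ℝ)) ^ 2 ≤ P ^ 2 := by rw [← sq_abs]; exact pow_le_pow_left₀ (abs_nonneg _) a0 2
        have e1' : fderiv ℝ φ y (EuclideanSpace.single (1 : Fin 3) (1 : ℝ)) ^ 2 ≤ P ^ 2 := by rw [← sq_abs]; exact pow_le_pow_left₀ (abs_nonneg _) a1 2
        linarith
    nlinarith [t1, t2, sq_nonneg (P - Q), mul_nonneg hKnn (sq_nonneg (P - Q))]
  -- the divergence is integrable
  have hdivfun := fun y => divergence_laplacianAxialFlux hφ hγ y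
  have idiv : Integrable (fun y => VectorCalculus.divergence (fun y : EuclideanSpace ℝ (Fin 3) => (γ (y 2) * fderiv ℝ (fun z => fderiv ℝ φ z (EuclideanSpace.single (2 : Fin 3) (1 : ℝ))) y (EuclideanSpace.single (2 : Fin 3) (1 : ℝ))) •
            ((fderiv ℝ φ y (EuclideanSpace.single (0 : Fin 3) (1 : ℝ))) • EuclideanSpace.single (0 : Fin 3) (1 : ℝ) +
              (fderiv ℝ φ y (EuclideanSpace.single (1 : Fin 3) (1 : ℝ))) • EuclideanSpace.single (1 : Fin 3) (1 : ℝ)) +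
          (-(γ (y 2) * (fderiv ℝ φ y (EuclideanSpace.single (0 : Fin 3) (1 : ℝ)) *
                fderiv ℝ (fun z => fderiv ℝ φ z (EuclideanSpace.single (2 : Fin 3) (1 : ℝ))) y (EuclideanSpace.single (0 : Fin 3) (1 : ℝ)) +
              fderiv ℝ φ y (EuclideanSpace.single (1 : Fin 3) (1 : ℝ)) *
                fderiv ℝ (fun z => fderiv ℝ φ z (EuclideanSpace.single (2 : Fin 3) (1 : ℝ))) y (EuclideanSpace.single (1 : Fin 3) (1 : ℝ)))) +
            (1 / 2) * deriv γ (y 2) * (fderiv ℝ φ y (EuclideanSpace.single (0 : Fin 3) (1 : ℝ)) ^ 2 +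
              fderiv ℝ φ y (EuclideanSpace.single (1 : Fin 3) (1 : ℝ)) ^ 2)) • EuclideanSpace.single (2 : Fin 3) (1 : ℝ)) y) volume := by
    simp_rw [hdivfun]
    have cq : ∀ v w : EuclideanSpace ℝ (Fin 3), Continuous fun y => fderiv ℝ (fun z => fderiv ℝ φ z v) y w := fun v w => (hDD v w).continuous
    have cp : ∀ v : EuclideanSpace ℝ (Fin 3), Continuous fun y => fderiv ℝ φ y v := fun v => (hD v).continuous
    have cγ0 : Continuous fun y : EuclideanSpace ℝ (Fin 3) => γ (y 2) := cγ.continuous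
    refine (((i2.const_mul (4 * K)).add (i1.const_mul K))).mono'
      ((((cγ0.mul ((cq _ _).add (cq _ _))).mul (cq _ _)).sub (cγ0.mul (((cq _ _).pow 2).add ((cq _ _).pow 2)))).add
        ((continuous_const.mul cγ'').mul (((cp _).pow 2).add ((cp _).pow 2)))).aestronglyMeasurable (Eventually.of_forall fun y => ?_)
    simp only [Pi.add_apply]
    have a0 := bp y _ n0; have a1 := bp y _ n1
    have d22 := bq y _ _ n2 n2; have d20 := bq y _ _ n2 n0; have d21 := bq y _ _ n2 n1; have d00 := bq y _ _ n0 n0; have d11 := bq y _ _ n1 n1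
    have g0 := hK0 (y 2); have g2 := hK2 (y 2)
    have hQ := norm_nonneg (iteratedFDeriv ℝ 2 φ y)
    have hP := norm_nonneg (fderiv ℝ φ y)
    have tA : |γ (y 2) * (fderiv ℝ (fun z => fderiv ℝ φ z (EuclideanSpace.single (0 : Fin 3) (1 : ℝ))) y (EuclideanSpace.single (0 : Fin 3) (1 : ℝ)) + fderiv ℝ (fun z => fderiv ℝ φ z (EuclideanSpace.single (1 : Fin 3) (1 : ℝ))) y (EuclideanSpace.single (1 : Fin 3) (1 : ℝ))) * fderiv ℝ (fun z => fderiv ℝ φ z (EuclideanSpace.single (2 : Fin 3) (1 : ℝ))) y (EuclideanSpace.single (2 : Fin 3) (1 : ℝ))| ≤ K * (‖iteratedFDeriv ℝ 2 φ y‖ + ‖iteratedFDeriv ℝ 2 φ y‖) * ‖iteratedFDeriv ℝ 2 φ y‖ := by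
      rw [abs_mul, abs_mul]
      exact mul_le_mul (mul_le_mul g0 ((abs_add_le _ _).trans (add_le_add d00 d11)) (abs_nonneg _) hKnn) d22 (abs_nonneg _) (by positivity)
    have tB : |γ (y 2) * (fderiv ℝ (fun z => fderiv ℝ φ z (EuclideanSpace.single (2 : Fin 3) (1 : ℝ))) y (EuclideanSpace.single (0 : Fin 3) (1 : ℝ)) ^ 2 + fderiv ℝ (fun z => fderiv ℝ φ z (EuclideanSpace.single (2 : Fin 3) (1 : ℝ))) y (EuclideanSpace.single (1 : Fin 3) (1 : ℝ)) ^ 2)| ≤ K * (‖iteratedFDeriv ℝ 2 φ y‖ ^ 2 + ‖iteratedFDeriv ℝ 2 φ y‖ ^ 2) := by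
      rw [abs_mul, abs_of_nonneg (by positivity : (0:ℝ) ≤ fderiv ℝ (fun z => fderiv ℝ φ z (EuclideanSpace.single (2 : Fin 3) (1 : ℝ))) y (EuclideanSpace.single (0 : Fin 3) (1 : ℝ)) ^ 2 + fderiv ℝ (fun z => fderiv ℝ φ z (EuclideanSpace.single (2 : Fin 3) (1 : ℝ))) y (EuclideanSpace.single (1 : Fin 3) (1 : ℝ)) ^ 2)]
      have e0' : fderiv ℝ (fun z => fderiv ℝ φ z (EuclideanSpace.single (2 : Fin 3) (1 : ℝ))) y (EuclideanSpace.single (0 : Fin 3) (1 : ℝ)) ^ 2 ≤ ‖iteratedFDeriv ℝ 2 φ y‖ ^ 2 := by rw [← sq_abs]; exact pow_le_pow_left₀ (abs_nonneg _) d20 2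
      have e1' : fderiv ℝ (fun z => fderiv ℝ φ z (EuclideanSpace.single (2 : Fin 3) (1 : ℝ))) y (EuclideanSpace.single (1 : Fin 3) (1 : ℝ)) ^ 2 ≤ ‖iteratedFDeriv ℝ 2 φ y‖ ^ 2 := by rw [← sq_abs]; exact pow_le_pow_left₀ (abs_nonneg _) d21 2
      exact mul_le_mul g0 (add_le_add e0' e1') (by positivity) hKnn
    have tC : |1 / 2 * deriv (deriv γ) (y 2) * (fderiv ℝ φ y (EuclideanSpace.single (0 : Fin 3) (1 : ℝ)) ^ 2 + fderiv ℝ φ y (EuclideanSpace.single (1 : Fin 3) (1 : ℝ)) ^ 2)| ≤ 1 / 2 * K * (‖fderiv ℝ φ y‖ ^ 2 + ‖fderiv ℝ φ y‖ ^ 2) := by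
      rw [abs_mul, abs_mul, abs_of_pos (by norm_num : (0:ℝ) < 1 / 2), abs_of_nonneg (by positivity : (0:ℝ) ≤ fderiv ℝ φ y (EuclideanSpace.single (0 : Fin 3) (1 : ℝ)) ^ 2 + fderiv ℝ φ y (EuclideanSpace.single (1 : Fin 3) (1 : ℝ)) ^ 2)]
      have e0' : fderiv ℝ φ y (EuclideanSpace.single (0 : Fin 3) (1 : ℝ)) ^ 2 ≤ ‖fderiv ℝ φ y‖ ^ 2 := by rw [← sq_abs]; exact pow_le_pow_left₀ (abs_nonneg _) a0 2
      have e1' : fderiv ℝ φ y (EuclideanSpace.single (1 : Fin 3) (1 : ℝ)) ^ 2 ≤ ‖fderiv ℝ φ y‖ ^ 2 := by rw [← sq_abs]; exact pow_le_pow_left₀ (abs_nonneg _) a1 2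
      exact mul_le_mul (mul_le_mul_of_nonneg_left g2 (by norm_num)) (add_le_add e0' e1') (by positivity) (by positivity)
    rw [Real.norm_eq_abs]
    calc |γ (y 2) * (fderiv ℝ (fun z => fderiv ℝ φ z (EuclideanSpace.single (0 : Fin 3) (1 : ℝ))) y (EuclideanSpace.single (0 : Fin 3) (1 : ℝ)) + fderiv ℝ (fun z => fderiv ℝ φ z (EuclideanSpace.single (1 : Fin 3) (1 : ℝ))) y (EuclideanSpace.single (1 : Fin 3) (1 : ℝ))) * fderiv ℝ (fun z => fderiv ℝ φ z (EuclideanSpace.single (2 : Fin 3) (1 : ℝ))) y (EuclideanSpace.single (2 : Fin 3) (1 : ℝ)) - γ (y 2) * (fderiv ℝ (fun z => fderiv ℝ φ z (EuclideanSpace.single (2 : Fin 3) (1 : ℝ))) y (EuclideanSpace.single (0 : Fin 3) (1 : ℝ)) ^ 2 + fderiv ℝ (fun z => fderiv ℝ φ z (EuclideanSpace.single (2 : Fin 3) (1 : ℝ))) y (EuclideanSpace.single (1 : Fin 3) (1 : ℝ)) ^ 2) + 1 / 2 * deriv (deriv γ) (y 2) * (fderiv ℝ φ y (EuclideanSpace.single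 (0 : Fin 3) (1 : ℝ)) ^ 2 + fderiv ℝ φ y (EuclideanSpace.single (1 : Fin 3) (1 : ℝ)) ^ 2)|
        ≤ |γ (y 2) * (fderiv ℝ (fun z => fderiv ℝ φ z (EuclideanSpace.single (0 : Fin 3) (1 : ℝ))) y (EuclideanSpace.single (0 : Fin 3) (1 : ℝ)) + fderiv ℝ (fun z => fderiv ℝ φ z (EuclideanSpace.single (1 : Fin 3) (1 : ℝ))) y (EuclideanSpace.single (1 : Fin 3) (1 : ℝ))) * fderiv ℝ (fun z => fderiv ℝ φ z (EuclideanSpace.single (2 : Fin 3) (1 : ℝ))) y (EuclideanSpace.single (2 : Fin 3) (1 : ℝ))| + |γ (y 2) * (fderiv ℝ (fun z => fderiv ℝ φ z (EuclideanSpace.single (2 : Fin 3) (1 : ℝ))) y (EuclideanSpace.single (0 : Fin 3) (1 : ℝ)) ^ 2 + fderiv ℝ (fun z => fderiv ℝ φ z (EuclideanSpace.single (2 : Fin 3) (1 : ℝ))) y (EuclideanSpace.single (1 : Fin 3) (1 : ℝ)) ^ 2)| + |1 / 2 * deriv (deriv γ) (y 2) * (fderiv ℝ φ y (EuclideanSpace.single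 (0 : Fin 3) (1 : ℝ)) ^ 2 + fderiv ℝ φ y (EuclideanSpace.single (1 : Fin 3) (1 : ℝ)) ^ 2)| := (abs_add_le _ _).trans (by linarith [abs_sub (γ (y 2) * (fderiv ℝ (fun z => fderiv ℝ φ z (EuclideanSpace.single (0 : Fin 3) (1 : ℝ))) y (EuclideanSpace.single (0 : Fin 3) (1 : ℝ)) + fderiv ℝ (fun z => fderiv ℝ φ z (EuclideanSpace.single (1 : Fin 3) (1 : ℝ))) y (EuclideanSpace.single (1 : Fin 3) (1 : ℝ))) * fderiv ℝ (fun z => fderiv ℝ φ z (EuclideanSpace.single (2 : Fin 3) (1 : ℝ))) y (EuclideanSpace.single (2 : Fin 3) (1 : ℝ))) (γ (y 2) * (fderiv ℝ (fun z => fderiv ℝ φ z (EuclideanSpace.single (2 : Fin 3) (1 : ℝ))) y (EuclideanSpace.single (0 : Fin 3) (1 : ℝ)) ^ 2 + fderiv ℝ (fun z => fderiv ℝ φ z (EuclideanSpace.single (2 : Fin 3) (1 : ℝ))) y (EuclideanSpace.single (1 : Fin 3) (1 : ℝ)) ^ 2))])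
      _ ≤ K * (‖iteratedFDeriv ℝ 2 φ y‖ + ‖iteratedFDeriv ℝ 2 φ y‖) * ‖iteratedFDeriv ℝ 2 φ y‖ +
            K * (‖iteratedFDeriv ℝ 2 φ y‖ ^ 2 + ‖iteratedFDeriv ℝ 2 φ y‖ ^ 2) + 1 / 2 * K * (‖fderiv ℝ φ y‖ ^ 2 + ‖fderiv ℝ φ y‖ ^ 2) :=
          add_le_add (add_le_add tA tB) tC
      _ = 4 * K * ‖iteratedFDeriv ℝ 2 φ y‖ ^ 2 + K * ‖fderiv ℝ φ y‖ ^ 2 := by ring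
  have h0 := integral_divergence_eq_zero_of_integrable hX1 iX idiv
  simp_rw [hdivfun] at h0
  -- split the integral of the divergence
  have cq : ∀ v w : EuclideanSpace ℝ (Fin 3), Continuous fun y => fderiv ℝ (fun z => fderiv ℝ φ z v) y w := fun v w => (hDD v w).continuous
  have cp : ∀ v : EuclideanSpace ℝ (Fin 3), Continuous fun y => fderiv ℝ φ y v := fun v => (hD v).continuous
  have cγ0 : Continuous fun y : EuclideanSpace ℝ (Fin 3) => γ (y 2) := cγ.continuous
  have jA : Integrable (fun y => γ (y 2) * (fderiv ℝ (fun z => fderiv ℝ φ z (EuclideanSpace.single (0 : Fin 3) (1 : ℝ))) y (EuclideanSpace.single (0 : Fin 3) (1 : ℝ)) + fderiv ℝ (fun z => fderiv ℝ φ z (EuclideanSpace.single (1 : Fin 3) (1 : ℝ))) y (EuclideanSpace.single (1 : Fin 3) (1 : ℝ))) * fderiv ℝ (fun z => fderiv ℝ φ z (EuclideanSpace.single (2 : Fin 3) (1 : ℝ))) y (EuclideanSpace.single (2 : Fin 3) (1 : ℝ))) volume := by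
    refine (i2.const_mul (2 * K)).mono' (((cγ0.mul ((cq _ _).add (cq _ _))).mul (cq _ _)).aestronglyMeasurable) (Eventually.of_forall fun y => ?_)
    have d22 := bq y _ _ n2 n2; have d00 := bq y _ _ n0 n0; have d11 := bq y _ _ n1 n1
    rw [Real.norm_eq_abs, abs_mul, abs_mul]
    calc |γ (y 2)| * |fderiv ℝ (fun z => fderiv ℝ φ z (EuclideanSpace.single (0 : Fin 3) (1 : ℝ))) y (EuclideanSpace.single (0 : Fin 3) (1 : ℝ)) + fderiv ℝ (fun z => fderiv ℝ φ z (EuclideanSpace.single (1 : Fin 3) (1 : ℝ))) y (EuclideanSpace.single (1 : Fin 3) (1 : ℝ))| * |fderiv ℝ (fun z => fderiv ℝ φ z (EuclideanSpace.single (2 : Fin 3) (1 : ℝ))) y (EuclideanSpace.single (2 : Fin 3) (1 : ℝ))|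
        ≤ K * (‖iteratedFDeriv ℝ 2 φ y‖ + ‖iteratedFDeriv ℝ 2 φ y‖) * ‖iteratedFDeriv ℝ 2 φ y‖ :=
          mul_le_mul (mul_le_mul (hK0 _) ((abs_add_le _ _).trans (add_le_add d00 d11)) (abs_nonneg _) hKnn) d22 (abs_nonneg _) (by positivity)
      _ = 2 * K * ‖iteratedFDeriv ℝ 2 φ y‖ ^ 2 := by ring
  have jB : Integrable (fun y => γ (y 2) * (fderiv ℝ (fun z => fderiv ℝ φ z (EuclideanSpace.single (2 : Fin 3) (1 : ℝ))) y (EuclideanSpace.single (0 : Fin 3) (1 : ℝ)) ^ 2 + fderiv ℝ (fun z => fderiv ℝ φ z (EuclideanSpace.single (2 : Fin 3) (1 : ℝ))) y (EuclideanSpace.single (1 : Fin 3) (1 : ℝ)) ^ 2)) volume := by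
    refine (i2.const_mul (2 * K)).mono' ((cγ0.mul (((cq _ _).pow 2).add ((cq _ _).pow 2))).aestronglyMeasurable) (Eventually.of_forall fun y => ?_)
    have d20 := bq y _ _ n2 n0; have d21 := bq y _ _ n2 n1
    rw [Real.norm_eq_abs, abs_mul, abs_of_nonneg (by positivity : (0:ℝ) ≤ _ ^ 2 + _ ^ 2)]
    have e0' : fderiv ℝ (fun z => fderiv ℝ φ z (EuclideanSpace.single (2 : Fin 3) (1 : ℝ))) y (EuclideanSpace.single (0 : Fin 3) (1 : ℝ)) ^ 2 ≤ ‖iteratedFDeriv ℝ 2 φ y‖ ^ 2 := by rw [← sq_abs]; exact pow_le_pow_left₀ (abs_nonneg _) d20 2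
    have e1' : fderiv ℝ (fun z => fderiv ℝ φ z (EuclideanSpace.single (2 : Fin 3) (1 : ℝ))) y (EuclideanSpace.single (1 : Fin 3) (1 : ℝ)) ^ 2 ≤ ‖iteratedFDeriv ℝ 2 φ y‖ ^ 2 := by rw [← sq_abs]; exact pow_le_pow_left₀ (abs_nonneg _) d21 2
    calc |γ (y 2)| * (fderiv ℝ (fun z => fderiv ℝ φ z (EuclideanSpace.single (2 : Fin 3) (1 : ℝ))) y (EuclideanSpace.single (0 : Fin 3) (1 : ℝ)) ^ 2 + fderiv ℝ (fun z => fderiv ℝ φ z (EuclideanSpace.single (2 : Fin 3) (1 : ℝ))) y (EuclideanSpace.single (1 : Fin 3) (1 : ℝ)) ^ 2) ≤ K * (‖iteratedFDeriv ℝ 2 φ y‖ ^ 2 + ‖iteratedFDeriv ℝ 2 φ y‖ ^ 2) :=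
          mul_le_mul (hK0 _) (add_le_add e0' e1') (by positivity) hKnn
      _ = 2 * K * ‖iteratedFDeriv ℝ 2 φ y‖ ^ 2 := by ring
  have jC : Integrable (fun y => (1 / 2) * deriv (deriv γ) (y 2) * (fderiv ℝ φ y (EuclideanSpace.single (0 : Fin 3) (1 : ℝ)) ^ 2 + fderiv ℝ φ y (EuclideanSpace.single (1 : Fin 3) (1 : ℝ)) ^ 2)) volume := by
    refine (i1.const_mul K).mono' (((continuous_const.mul cγ'').mul (((cp _).pow 2).add ((cp _).pow 2))).aestronglyMeasurable)
      (Eventually.of_forall fun y => ?_)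
    have a0 := bp y _ n0; have a1 := bp y _ n1
    rw [Real.norm_eq_abs, abs_mul, abs_mul, abs_of_pos (by norm_num : (0:ℝ) < 1 / 2), abs_of_nonneg (by positivity : (0:ℝ) ≤ _ ^ 2 + _ ^ 2)]
    have e0' : fderiv ℝ φ y (EuclideanSpace.single (0 : Fin 3) (1 : ℝ)) ^ 2 ≤ ‖fderiv ℝ φ y‖ ^ 2 := by rw [← sq_abs]; exact pow_le_pow_left₀ (abs_nonneg _) a0 2
    have e1' : fderiv ℝ φ y (EuclideanSpace.single (1 : Fin 3) (1 : ℝ)) ^ 2 ≤ ‖fderiv ℝ φ y‖ ^ 2 := by rw [← sq_abs]; exact pow_le_pow_left₀ (abs_nonneg _) a1 2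
    calc 1 / 2 * |deriv (deriv γ) (y 2)| * (fderiv ℝ φ y (EuclideanSpace.single (0 : Fin 3) (1 : ℝ)) ^ 2 + fderiv ℝ φ y (EuclideanSpace.single (1 : Fin 3) (1 : ℝ)) ^ 2) ≤ 1 / 2 * K * (‖fderiv ℝ φ y‖ ^ 2 + ‖fderiv ℝ φ y‖ ^ 2) :=
          mul_le_mul (mul_le_mul_of_nonneg_left (hK2 _) (by norm_num)) (add_le_add e0' e1') (by positivity) (by positivity)
      _ = K * ‖fderiv ℝ φ y‖ ^ 2 := by ring
  have jAB : Integrable (fun y => γ (y 2) * (fderiv ℝ (fun z => fderiv ℝ φ z (EuclideanSpace.single (0 : Fin 3) (1 : ℝ))) y (EuclideanSpace.single (0 : Fin 3) (1 : ℝ)) + fderiv ℝ (fun z => fderiv ℝ φ z (EuclideanSpace.single (1 : Fin 3) (1 : ℝ))) y (EuclideanSpace.single (1 : Fin 3) (1 : ℝ))) * fderiv ℝ (fun z => fderiv ℝ φ z (EuclideanSpace.single (2 : Fin 3) (1 : ℝ))) y (EuclideanSpace.single (2 : Fin 3) (1 : ℝ)) - γ (y 2) * (fderiv ℝ (fun z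 => fderiv ℝ φ z (EuclideanSpace.single (2 : Fin 3) (1 : ℝ))) y (EuclideanSpace.single (0 : Fin 3) (1 : ℝ)) ^ 2 + fderiv ℝ (fun z => fderiv ℝ φ z (EuclideanSpace.single (2 : Fin 3) (1 : ℝ))) y (EuclideanSpace.single (1 : Fin 3) (1 : ℝ)) ^ 2)) volume := jA.sub jB
  have e1 := integral_add jAB jC
  have e2 := integral_sub jA jB
  have e3 : (∫ y, 1 / 2 * deriv (deriv γ) (y 2) * (fderiv ℝ φ y (EuclideanSpace.single (0 : Fin 3) (1 : ℝ)) ^ 2 + fderiv ℝ φ y (EuclideanSpace.single (1 : Fin 3) (1 : ℝ)) ^ 2)) = 1 / 2 * ∫ y, deriv (deriv γ) (y 2) * (fderiv ℝ φ y (EuclideanSpace.single (0 : Fin 3) (1 : ℝ)) ^ 2 + fderiv ℝ φ y (EuclideanSpace.single (1 : Fin 3) (1 : ℝ)) ^ 2) := by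
    rw [← integral_const_mul]
    refine integral_congr_ae (Eventually.of_forall fun y => ?_)
    dsimp only
    ring
  rw [e1, e2, e3] at h0
  linarith

end ExtremiserLiouville

end Summit.NavierStokesRegularity.NavierStokesRegularity.Theorems

end
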